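import Literature.AlgebraicGeometry.Modules.SheafHomFrames
import Literature.AlgebraicGeometry.Modules.FrameTransition
import HarnessLib

/-!
# [OURS · L1 W4.5(b) · LINE (T-j)-PROOF support, (β₁)/(β) tool] The transition matrix of the Hom-frame:
# `T(hom(f,w), hom(f′,w′))_{(j,k),(j′,k′)} = T(f′,f)_{j′j} · T(w,w′)_{kk′}` (Kronecker / inverse-transpose rule)

Cell res-hironaka, LADDER-RESOLUTION rung L, slot W4.5(b), crux chain w45b: EL♮(3) = stmt-ResolutionOfSingularities-20148, residue (T-j) = F-102
(LINE (T-j)-PROOF brick B4 (γ*): the pullback-vs-sheafHom brick (β₁)/(β) and the downstairs iso (γ) are run through the tree's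
`Modules/IsoOfFrames.isoOfFrames`, which needs the TRANSITION MATRICES of the Hom-frames `SheafHomFrames.homFrame`; the tree had
`coord_homFrame` but not this transition rule — cf. res-D-pv-036 GO/NO-GO 2026-08-27T22:12:38Z). res-L1-w45b-plan-1 22:38:49Z «(β₁) → 036
provisionally»; seat res-D-pv-036 g11 (on-call supplier). `--supports stmt-ResolutionOfSingularities-20148 --as helper`. NOT a statement of any
manuscript; OURS; AI-written, weaker than expert review. Definition-free; standard axioms.

For frames `f : 𝒪^J ≅ F|_W`, `w : 𝒪^K ≅ G|_W` and `f′ : 𝒪^{J′} ≅ F|_{W′}`, `w′ : 𝒪^{K′} ≅ G|_{W′}` and `V` below `W`, `W′`: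
* `transition_homFrame` — the transition matrix between the matrix-unit frames `homFrame f w`, `homFrame f′ w′` of `𝓗om(F, G)` is
  `((j,k), (j′,k′)) ↦ T(f′, f)_{j′ j} · T(w, w′)_{k k′}` — i.e. `T(f, f′)⁻ᵀ ⊗ T(w, w′)` (Hartshorne II Ex. 5.1 (b): `𝓗om(F, G) ≅ F^∨ ⊗ G`);
* `transition_homFrame_punit` — the RANK-ONE reading (`J = K = J′ = K′ = PUnit`): a product of two scalars.
Consequence for (β₁)/(β): with `transition_pullbackFrame` both `i^*𝓗om(M, N)` and `𝓗om(i^*M, i^*N)` carry frames on the pulled-back common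
cover whose transition matrices are `i♯` of this product, so `isoOfFrames` applies. [cite: Hartshorne1977, II Ex. 5.1] [folklore]
-/

noncomputable section

open CategoryTheory AlgebraicGeometry Opposite TopologicalSpace
open Literature.AlgebraicGeometry.Modules Literature.AlgebraicGeometry.Motives

set_option linter.dupNamespace false

namespace Summit.ResolutionOfSingularities.ResolutionOfSingularities.Cruxes.EquisingularLiftNat.F102

universe u

variable {X : Scheme.{u}} {F G : X.Modules} {W W' V : X.Opens} {J K J' K' : Type u}
  [Fintype J] [Fintype K] [Fintype J'] [Fintype K']
  (f : SheafOfModules.free J ≅ F.over W) (w : SheafOfModules.free K ≅ G.over W)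
  (f' : SheafOfModules.free J' ≅ F.over W') (w' : SheafOfModules.free K' ≅ G.over W')

/-- **Transition matrices of Hom-frames (Kronecker rule)**: over `V ≤ W ⊓ W′`,
`T(homFrame f w, homFrame f′ w′)_{(j,k),(j′,k′)} = T(f′, f)_{j′ j} · T(w, w′)_{k k′}`: the `(j,k)`-coordinate of the restricted matrix unit
`β′_{(j′,k′)} = λ^{f′}_{j′} ⊗ g′_{k′}` is `λ^w_k(β′(b^f_j|)) = λ^{f′}_{j′}(b^f_j|) · λ^w_k(g′_{k′}|)`. [cite: Hartshorne1977, II Ex. 5.1] [folklore] -/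
theorem transition_homFrame (k : V ⟶ W) (k' : V ⟶ W') (jk : J × K) (jk' : J' × K') :
    transition (homFrame f w) (homFrame f' w') k k' jk jk' =
      transition f' f k' k jk'.1 jk.1 * transition w w' k k' jk.2 jk'.2 := by
  rw [transition_apply, transition_apply, transition_apply, basisSection_homFrame]
  change coord (homFrame f w) k ((restrictHom k' (homBasis f' w' jk') : F.over V ⟶ G.over V) : Γ(sheafHom F G, V)) jk = _
  rw [coord_homFrame, appLE_restrictHom, Category.id_comp, appLE_homBasis, coord_smul]

/-- **Rank-one reading** (`J = K = J′ = K′ = PUnit`, LINE BUNDLES `F`, `G`): the transition SCALAR of the Hom-frames is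
`T(f′, f) · T(w, w′)` — with `T(f′, f) = T(f, f′)⁻¹` (`transition_mul_symm`) this is the rule «transition of `𝓗om(L, L′)` =
transition of `L′` divided by transition of `L`». [cite: Hartshorne1977, II Ex. 5.1] [folklore] -/
theorem transition_homFrame_punit (f₁ : SheafOfModules.free PUnit.{u + 1} ≅ F.over W) (w₁ : SheafOfModules.free PUnit.{u + 1} ≅ G.over W)
    (f₁' : SheafOfModules.free PUnit.{u + 1} ≅ F.over W') (w₁' : SheafOfModules.free PUnit.{u + 1} ≅ G.over W')
    (k : V ⟶ W) (k' : V ⟶ W') :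
    transition (homFrame f₁ w₁) (homFrame f₁' w₁') k k' (PUnit.unit, PUnit.unit) (PUnit.unit, PUnit.unit) =
      transition f₁' f₁ k' k PUnit.unit PUnit.unit * transition w₁ w₁' k k' PUnit.unit PUnit.unit :=
  transition_homFrame f₁ w₁ f₁' w₁' k k' _ _

end Summit.ResolutionOfSingularities.ResolutionOfSingularities.Cruxes.EquisingularLiftNat.F102

end
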